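import Summits.CriticalPhenomena.PercolationContinuityZ3.Theorems.SoloBlindSlitRate
import Summits.CriticalPhenomena.PercolationContinuityZ3.Theorems.SoloBlindPeriodicFinAllRoots
import HarnessLib

/-!
# A plane wall with a periodic line of pores, IV: the family `slitPeriods`, every root

Seat `solo-CriticalPhenomena-blind`.  `slitPeriods = {M : θ_{ℤ³[R_M]}(0, p_c) = 0}`,
`R_M = {0 ≤ x₀} ∪ {x₀ ≤ -2} ∪ {(-1,0,Mj)}`, parallels `finPeriods` (`SoloBlindPeriodicFinLadder`):

* `zero_mem_slitPeriods` — UNCONDITIONALLY `0 ∈ slitPeriods` (a single pore: no admissible chain of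
  length two, so the contraction number is `0`);
* `slitPeriods_dvd_closed` — `M ∣ M'`, `M ∈ slitPeriods ⟹ M' ∈ slitPeriods` (`R_{M'} ⊆ R_M`);
* `slitPeriods_eq_univ_iff` — `slitPeriods = ℕ ↔ 1 ∈ slitPeriods`; under `T₀ ≤ 2` it is all of `ℕ`
  (`slitPeriods_eq_univ_of_T0_le_two`), under `LineRate` cofinite, under the summit all of `ℕ`;
* `slitRegion_induce_connected` — `ℤ³[R_M]` is connected, hence for `M ∈ slitPeriods` the
  percolation probability vanishes at EVERY root and a.s. there is no infinite cluster
  (`theta_eq_zero_of_mem_slitPeriods`, `measure_iUnion_percolatesVia_slit_eq_zero`).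
-/

noncomputable section

namespace Summit.CriticalPhenomena.PercolationContinuityZ3.Theorems

open MeasureTheory Filter Topology Literature.Probability.Percolation Literature.Probability.LatticeModels
open scoped ENNReal

/-! ### The family -/

/-- For the single pore (`M = 0`) the admissibility indicator vanishes identically. -/
theorem admInd_ZM_zero (z z' : ℤ) : admInd (ZM 0) z z' = 0 := by
  refine admInd_eq_zero ?_
  rintro ⟨hz, hz', hne⟩
  have h1 : z = 0 := zero_dvd_iff.1 (by simpa [ZM] using hz)
  have h2 : z' = 0 := zero_dvd_iff.1 (by simpa [ZM] using hz')
  exact hne (by rw [h1, h2])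

/-- **`0 ∈ slitPeriods` unconditionally**: the wall with a single pore does not percolate at `p_c`. -/
theorem zero_mem_slitPeriods : 0 ∈ slitPeriods := by
  intro h0
  have hker : ∀ s, kerTot (kerL (ZM 0)) s = 0 := by
    intro s
    refine le_antisymm (iSup_le fun z => ?_) bot_le
    have : ∀ z', kerL (ZM 0) s z z' = 0 := fun z' => by
      rw [kerL, admInd_ZM_zero, zero_mul]
    simp [tsum_congr this]
  have hρ : kerTot (kerL (ZM 0)) true * kerTot (kerL (ZM 0)) false < 1 := by
    rw [hker true, zero_mul]; exact zero_lt_one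
  have hstart : ∀ z, z ≠ 0 → startL (ZM 0) (0 : Site 3) true z = 0 := by
    intro z hz
    have : z ∉ ZM 0 := fun h => hz (zero_dvd_iff.1 (by simpa [ZM] using h))
    rw [startL, Set.indicator_of_notMem this, zero_mul]
  have hΓ : ∑' z, startL (ZM 0) (0 : Site 3) true z ≠ ⊤ := by
    rw [tsum_eq_single 0 fun z hz => hstart z hz]
    refine ne_top_of_le_ne_top ENNReal.one_ne_top ?_
    unfold startL
    calc Set.indicator (ZM 0) (fun _ => (1 : ℝ≥0∞)) 0 *
          (Pc (openConnVia (KL0 (ZM 0)) 0 (cpt true 0)) * Pc {ω | s(cpt true 0, cpt (!true) 0) ∈ ω})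
        ≤ 1 * (1 * 1) :=
          mul_le_mul' (Set.indicator_le (fun _ _ => le_rfl) _) (mul_le_mul' prob_le_one prob_le_one)
      _ = 1 := by rw [one_mul, one_mul]
  have hzero := measure_percolatesVia_KL_eq_zero (Z := ZM 0) (0 : Site 3) true zero_mem_hsp hΓ hρ
  rw [theta_induce_eq_real_percolatesVia, measureReal_def]
  change (Pc (percolatesVia (KL (ZM 0)) 0)).toReal = 0
  rw [hzero, ENNReal.toReal_zero]

/-- The slit regions decrease along divisibility: `M ∣ M' ⟹ R_{M'} ⊆ R_M`. -/
theorem slitRegion_anti {M M' : ℕ} (h : M ∣ M') : slitRegion M' ⊆ slitRegion M := by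
  rintro x (hx | hx)
  · exact Or.inl hx
  · rcases hx with hx | ⟨h0, h1, hz⟩
    · exact Or.inr (Or.inl hx)
    · exact Or.inr (Or.inr ⟨h0, h1, (Int.natCast_dvd_natCast.2 h).trans hz⟩)

/-- `slitPeriods` is an upper set for divisibility. -/
theorem slitPeriods_dvd_closed {M M' : ℕ} (h : M ∣ M') (hM : M ∈ slitPeriods) : M' ∈ slitPeriods := by
  intro h0
  refine le_antisymm ?_ ?_
  · calc theta ((zdGraph 3).induce (slitRegion M')) ⟨0, h0⟩ (criticalProbI 3)
          ≤ theta ((zdGraph 3).induce (slitRegion M)) ⟨0, slitRegion_anti h h0⟩ (criticalProbI 3) :=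
            theta_induce_mono_holds (zdGraph 3) (slitRegion_anti h) 0 h0 _
      _ = 0 := hM _
  · unfold theta; exact measureReal_nonneg

/-- `slitPeriods = ℕ ↔ 1 ∈ slitPeriods` (period one is the full line slit). -/
theorem slitPeriods_eq_univ_iff : slitPeriods = Set.univ ↔ 1 ∈ slitPeriods := by
  constructor
  · intro h; rw [h]; exact Set.mem_univ 1
  · intro h; exact Set.eq_univ_of_forall fun M => slitPeriods_dvd_closed (one_dvd M) h

/-- **`T₀ ≤ 2 ⟹ slitPeriods = ℕ`**: every slit wall, hence every periodic fin, is good. -/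
theorem slitPeriods_eq_univ_of_T0_le_two (h : T0 ≤ 2) : slitPeriods = Set.univ :=
  slitPeriods_eq_univ_iff.2 (one_mem_slitPeriods_of_T0_le_two h)

/-- Under `LineRate` the set of bad slit periods is finite. -/
theorem finite_compl_slitPeriods_of_lineRate (hL : SoloBlindOpenRungs.LineRate) :
    (slitPeriodsᶜ).Finite := by
  obtain ⟨M₀, hM₀⟩ := eventually_atTop.1 (eventually_mem_slitPeriods_of_lineRate hL)
  refine (Set.finite_lt_nat M₀).subset fun M hM => ?_
  by_contra hlt
  exact hM (hM₀ M (not_lt.1 hlt))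

/-- `slitPeriods ⊆ finPeriods`. -/
theorem slitPeriods_subset_finPeriods : slitPeriods ⊆ finPeriods :=
  fun _ h => mem_finPeriods_of_mem_slitPeriods h

/-! ### `ℤ³[R_M]` is connected -/

/-- Every site of `R_M` is joined to the origin inside `ℤ³[R_M]`: sites of `S_M ⊆ R_M` by the
connectedness of `ℤ³[S_M]`; a site with `x₀ ≤ -2` first moves its coordinate `1` to `0` (staying in
`{x₀ ≤ -2}`), landing in the fin half-plane of `S_M`. -/
theorem slitRegion_reachable_zero (M : ℕ) (x : Site 3) (hx : x ∈ slitRegion M) :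
    ((zdGraph 3).induce (slitRegion M)).Reachable ⟨x, hx⟩ ⟨0, zero_mem_slitRegion M⟩ := by
  have hsub := periodicFinRegion_subset_slitRegion M
  by_cases hS : x ∈ periodicFinRegion M
  · exact (reachable_zero M x hS).map (SimpleGraph.induceHomOfLE (zdGraph 3) hsub).toHom
  · have hx0 : x 0 ≤ -2 := by
      rcases hx with hx | hx | ⟨h0, h1, hz⟩
      · exact absurd (Or.inl hx) hS
      · exact hx
      · exact absurd (Or.inr (Or.inr ⟨h1, h0, hz⟩)) hS
    have h1 : ∀ t ∈ Set.uIcc (x 1) 0, Function.update x 1 t ∈ slitRegion M :=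
      fun t _ => Or.inr (Or.inl (by simpa using hx0))
    have hy := h1 0 Set.right_mem_uIcc
    have hyS : Function.update x 1 (0 : ℤ) ∈ periodicFinRegion M :=
      Or.inr (Or.inl ⟨by simp, by simpa using hx0⟩)
    exact (induce_reachable_update hx 1 0 h1 hy).trans
      ((reachable_zero M _ hyS).map (SimpleGraph.induceHomOfLE (zdGraph 3) hsub).toHom)

/-- **`ℤ³[R_M]` is connected.** -/
theorem slitRegion_induce_connected (M : ℕ) : ((zdGraph 3).induce (slitRegion M)).Connected :=
  { preconnected := fun a b =>
      (slitRegion_reachable_zero M a.1 a.2).trans (slitRegion_reachable_zero M b.1 b.2).symm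
    nonempty := ⟨⟨0, zero_mem_slitRegion M⟩⟩ }

/-! ### All roots, no infinite cluster -/

/-- **All roots.** For `M ∈ slitPeriods`, `θ_{ℤ³[R_M]}(x, p_c) = 0` at every `x ∈ R_M`. -/
theorem theta_eq_zero_of_mem_slitPeriods {M : ℕ} (hM : M ∈ slitPeriods) (x : Site 3)
    (hx : x ∈ slitRegion M) :
    theta ((zdGraph 3).induce (slitRegion M)) ⟨x, hx⟩ (criticalProbI 3) = 0 := by
  by_contra hne
  have hpos : 0 < theta ((zdGraph 3).induce (slitRegion M)) ⟨x, hx⟩ (criticalProbI 3) :=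
    lt_of_le_of_ne measureReal_nonneg (Ne.symm hne)
  have h0 := RegionGluing.theta_pos_of_reachable_root _ (slitRegion_reachable_zero M x hx).symm _ hpos
  exact h0.ne' (hM _)

/-- **No infinite cluster.** For `M ∈ slitPeriods`, `P_{p_c}`-a.s. `ℤ³[R_M]` has no infinite open cluster. -/
theorem measure_iUnion_percolatesVia_slit_eq_zero {M : ℕ} (hM : M ∈ slitPeriods) :
    bondPercolation (zdGraph 3) (criticalProbI 3)
      (⋃ x ∈ slitRegion M, percolatesVia (withinGraph (zdGraph 3) (slitRegion M)) x) = 0 := by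
  refine (measure_biUnion_null_iff (Set.to_countable _)).2 fun x hx => ?_
  have h := theta_eq_zero_of_mem_slitPeriods hM x hx
  rwa [theta_induce_eq_real_percolatesVia, measureReal_eq_zero_iff (measure_ne_top _ _)] at h

/-- **`T₀ ≤ 2 ⟹` no slit wall and no periodic fin percolates at `p_c`, at any root.** -/
theorem slit_noInfiniteCluster_of_T0_le_two (h : T0 ≤ 2) (M : ℕ) :
    bondPercolation (zdGraph 3) (criticalProbI 3)
      (⋃ x ∈ slitRegion M, percolatesVia (withinGraph (zdGraph 3) (slitRegion M)) x) = 0 :=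
  measure_iUnion_percolatesVia_slit_eq_zero (by rw [slitPeriods_eq_univ_of_T0_le_two h]; trivial)

/-- **Slit walls under `LineRate`, no infinite cluster.** For all large `M`, `P_{p_c}`-a.s. the wall
with a period-`M` line of pores has no infinite open cluster. -/
theorem slit_noInfiniteCluster_of_lineRate (hL : SoloBlindOpenRungs.LineRate) :
    ∃ M₀ : ℕ, ∀ M : ℕ, M₀ ≤ M →
      bondPercolation (zdGraph 3) (criticalProbI 3)
        (⋃ x ∈ slitRegion M, percolatesVia (withinGraph (zdGraph 3) (slitRegion M)) x) = 0 := by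
  obtain ⟨M₀, hM₀⟩ := eventually_atTop.1 (eventually_mem_slitPeriods_of_lineRate hL)
  exact ⟨M₀, fun M hM => measure_iUnion_percolatesVia_slit_eq_zero (hM₀ M hM)⟩

end Summit.CriticalPhenomena.PercolationContinuityZ3.Theorems

end
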